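import Literature.Analysis.FluidPDE.PassiveVectorTensorGalerkin
import Literature.Analysis.FluidPDE.PassiveVectorGalerkinEnstrophyTools
import HarnessLib

/-!
# The Fourier–Galerkin scheme for the constant-tensor passive solenoidal vector, II: the ENSTROPHY Grönwall bound

Analysis/FluidPDE proof-support file (everything proved; no definitions, no named facts). Along a solution `α`
of the tensor Galerkin system `α' = pvtGalerkinRHS S 𝔸 (β t) α` (`PassiveVectorTensorGalerkin`) with
`NearIso 𝔸 lo hi`, `lo ≥ 0`, a real divergence-free carrier curve `β` whose physical field
`b(t) = realTrigPoly S (β t)` has bounded gradient `|∂_j b_a(t,x)| ≤ G` on the time window, the Galerkin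
enstrophy `Z(t) = 4π² Σ_k |k|² ‖α t k‖² = ‖∇u_N(t)‖²` satisfies

* `pvtEnstrophy_deriv_le` — `Z' = Σ_k 4π²|k|²·2Re⟪α_k, V_k⟫ ≤ 2·(card d)·G·Z` (the tensor viscous term is
  `≤ 0` by `sum_freqNormSq_mul_re_inner_leraySym_symbT_nonneg` — no condition on the odd part of `𝔸`; the drift
  term is `−Σ_j∫⟪∂_j u, ∂_j((b·∇)u)⟫` by the weighted Parseval identity and is bounded by the transport
  enstrophy bound);
* `pvtEnstrophy_le_exp_mul` — **Grönwall**: `Z(t₂) ≤ exp(2·(card d)·G·(t₂ − t₁))·Z(t₁)` for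
  `0 ≤ t₁ ≤ t₂ ≤ s'`, and the same written with `‖∇ realTrigPoly S ᾱ‖²` (`gradNormSq`).

Cell `ad-ideate`, K1L_D, tenure ruling D26-17 (S2′) (quasi-monotonicity of the dissipation at the Galerkin
level; Robinson–Rodrigo–Sadowski 2016, §6.1; Constantin–Foias 1988, Ch. 9).

## References

* J. C. Robinson, J. L. Rodrigo, W. Sadowski, *The three-dimensional Navier–Stokes equations* (CUP 2016), Thm. 4.4
  Step 2, §6.1. [`RobinsonRodrigoSadowski2016`]
* P. Constantin, C. Foias, *Navier–Stokes Equations* (Chicago 1988), Ch. 8 (8.3)–(8.9), Ch. 9. [`ConstantinFoias1988`]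
-/

open MeasureTheory Set Filter Topology UnitAddTorus
open scoped ENNReal NNReal InnerProductSpace

noncomputable section

namespace Literature.Analysis.FluidPDE

open FunctionSpaces.Torus FunctionSpaces Torus

variable {d : Type*} [Fintype d] [DecidableEq d] {S : Finset (d → ℤ)}

/-- **The enstrophy balance of the tensor Galerkin system**: for `NearIso 𝔸 lo hi`, `lo ≥ 0`, a real
divergence-free state `c` and carrier `β` on a symmetric `S` with `|∂_j (realTrigPoly S β̄)_a| ≤ G` pointwise,
`Σ_k 4π²|k|² · 2Re⟪c k, V(β,c) k⟫ ≤ 2·(card d)·G · 4π² Σ_k |k|² ‖c k‖²`.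
[cite: RobinsonRodrigoSadowski2016, §6.1] [cite: ConstantinFoias1988, Ch. 9] -/
theorem pvtEnstrophy_deriv_le {𝔸 : Visc4 d} {lo hi : ℝ} (h𝔸 : NearIso 𝔸 lo hi) (hlo : 0 ≤ lo)
    (hS : ∀ k ∈ S, -k ∈ S) {c β : ↥S → EuclideanSpace ℂ d} (hc : c ∈ galerkinSubspace S)
    (hβ : IsRealCoeff β) (hβT : IsSolenoidalCoeff β) {G : ℝ} (hG0 : 0 ≤ G)
    (hG : ∀ x j a, |FunctionSpaces.Torus.partialDeriv j (realTrigPoly S (coeffExt S β)) x a| ≤ G) :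
    ∑ k : ↥S, 4 * Real.pi ^ 2 * freqNormSq (k : d → ℤ) * (2 * (inner ℂ (c k) (pvtGalerkinRHS S 𝔸 β c k)).re) ≤
      2 * ((Fintype.card d : ℝ) * G) * ∑ k : ↥S, 4 * Real.pi ^ 2 * freqNormSq (k : d → ℤ) * ‖c k‖ ^ 2 := by
  have hcs : IsConjSymm (coeffExt S c) := hc.1.isConjSymm_coeffExt hS
  have hcT : IsTransversal S (coeffExt S c) := hc.2.isTransversal_coeffExt
  have hβs : IsConjSymm (coeffExt S β) := hβ.isConjSymm_coeffExt hS
  have hβT' : IsTransversal S (coeffExt S β) := hβT.isTransversal_coeffExt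
  set u := realTrigPoly S (coeffExt S c) with hu
  set b := realTrigPoly S (coeffExt S β) with hb
  have hus : IsSmooth u := isSmooth_realTrigPoly S _
  have hbs : IsSmooth b := isSmooth_realTrigPoly S _
  have hbdiv : IsDivFree b := isDivFree_realTrigPoly hβT'
  -- pass to sums over `k ∈ S` of the extended family
  have eL : ∑ k : ↥S, 4 * Real.pi ^ 2 * freqNormSq (k : d → ℤ) * (2 * (inner ℂ (c k) (pvtGalerkinRHS S 𝔸 β c k)).re) =
      2 * ∑ k ∈ S, 4 * Real.pi ^ 2 * freqNormSq k *
        (inner ℂ (coeffExt S c k) (pvtGalerkinField 𝔸 S (coeffExt S β) (coeffExt S c) k)).re := by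
    simp_rw [pvtGalerkinRHS_apply]
    rw [← sum_coeffExt (fun k v => 4 * Real.pi ^ 2 * freqNormSq k *
      (2 * (inner ℂ v (pvtGalerkinField 𝔸 S (coeffExt S β) (coeffExt S c) k)).re)) c, Finset.mul_sum]
    exact Finset.sum_congr rfl fun k _ => by ring
  have eR : ∑ k : ↥S, 4 * Real.pi ^ 2 * freqNormSq (k : d → ℤ) * ‖c k‖ ^ 2 =
      4 * Real.pi ^ 2 * ∑ k ∈ S, freqNormSq k * ‖coeffExt S c k‖ ^ 2 := by
    rw [← sum_coeffExt (fun k v => 4 * Real.pi ^ 2 * freqNormSq k * ‖v‖ ^ 2) c, Finset.mul_sum]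
    exact Finset.sum_congr rfl fun k _ => by ring
  rw [eL, eR]
  -- split the field
  have hsplit : ∀ k ∈ S, 4 * Real.pi ^ 2 * freqNormSq k *
      (inner ℂ (coeffExt S c k) (pvtGalerkinField 𝔸 S (coeffExt S β) (coeffExt S c) k)).re =
      -(16 * Real.pi ^ 4 * (freqNormSq k *
        (inner ℂ (coeffExt S c k) (leraySym k (symbT 𝔸 k (coeffExt S c k)))).re)) -
        4 * Real.pi ^ 2 * freqNormSq k *
          (inner ℂ (coeffExt S c k) (convectionCoeff S (coeffExt S β) (coeffExt S c) k)).re := by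
    intro k hk
    rw [pvtGalerkinField_def, inner_sub_right, Complex.sub_re, inner_neg_right, Complex.neg_re, inner_smul_right,
      Complex.re_ofReal_mul, inner_leraySym_right_of_transversal _ (convectionCoeff S _ _ k) (hcT k hk)]
    ring
  rw [Finset.sum_congr rfl hsplit, Finset.sum_sub_distrib, Finset.sum_neg_distrib, ← Finset.mul_sum]
  -- the viscous term has a sign
  have hvisc := (sum_freqNormSq_mul_re_inner_leraySym_symbT_nonneg (S := S) h𝔸 hlo hcT).2
  -- the drift term in physical space
  have hconv : ∀ k ∈ S, 4 * Real.pi ^ 2 * freqNormSq k *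
      (inner ℂ (coeffExt S c k) (convectionCoeff S (coeffExt S β) (coeffExt S c) k)).re =
      4 * Real.pi ^ 2 * freqNormSq k *
        (inner ℂ (coeffExt S c k) (mFourierCoeff (EuclideanSpace.complexify ∘ FunctionSpaces.Torus.convect b u) k)).re := by
    intro k _
    rw [mFourierCoeff_convect_realTrigPoly hS hβs hcs k]
  rw [Finset.sum_congr rfl hconv, sum_freqNormSq_mul_re_inner_eq hS hcs (hbs.convect hus)]
  have hdrift := abs_sum_integral_inner_partialDeriv_convect_le hbs hbdiv hus hG0 hG
  rw [gradNormSq_realTrigPoly hS hcs] at hdrift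
  have h1 := neg_le_of_abs_le hdrift
  have hV : 0 ≤ 16 * Real.pi ^ 4 * ∑ k ∈ S, freqNormSq k *
      (inner ℂ (coeffExt S c k) (leraySym k (symbT 𝔸 k (coeffExt S c k)))).re :=
    mul_nonneg (by positivity) hvisc
  nlinarith [hV, h1, hG0]

/-- **Enstrophy Grönwall bound for tensor Galerkin solutions.** Let `α` solve the tensor Galerkin ODE on `[0,s']`
(`NearIso 𝔸 lo hi`, `lo ≥ 0`), staying real divergence free, along a real divergence-free carrier curve `β`
with `|∂_j (realTrigPoly S β̄(t))_a(x)| ≤ G` for `t ∈ [0,s']`. Then for `0 ≤ t₁ ≤ t₂ ≤ s'`: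
`4π²Σ_k|k|²‖α t₂ k‖² ≤ exp(2·(card d)·G·(t₂ − t₁)) · 4π²Σ_k|k|²‖α t₁ k‖²`.
[cite: RobinsonRodrigoSadowski2016, §6.1] [cite: ConstantinFoias1988, Ch. 9] -/
theorem pvtEnstrophy_le_exp_mul {𝔸 : Visc4 d} {lo hi : ℝ} (h𝔸 : NearIso 𝔸 lo hi) (hlo : 0 ≤ lo)
    (hS : ∀ k ∈ S, -k ∈ S)
    {β : ℝ → ↥S → EuclideanSpace ℂ d} (hβr : ∀ t, IsRealCoeff (β t)) (hβT : ∀ t, IsSolenoidalCoeff (β t))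
    {s' : ℝ} {α : ℝ → ↥S → EuclideanSpace ℂ d}
    (hα : ∀ t ∈ Icc 0 s', HasDerivWithinAt α (pvtGalerkinRHS S 𝔸 (β t) (α t)) (Icc 0 s') t)
    (hmem : ∀ t ∈ Icc 0 s', α t ∈ galerkinSubspace S) {G : ℝ} (hG0 : 0 ≤ G)
    (hG : ∀ t ∈ Icc 0 s', ∀ x j a, |FunctionSpaces.Torus.partialDeriv j (realTrigPoly S (coeffExt S (β t))) x a| ≤ G)
    {t₁ t₂ : ℝ} (h0 : 0 ≤ t₁) (h12 : t₁ ≤ t₂) (h2 : t₂ ≤ s') :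
    ∑ k : ↥S, 4 * Real.pi ^ 2 * freqNormSq (k : d → ℤ) * ‖α t₂ k‖ ^ 2 ≤
      Real.exp (2 * ((Fintype.card d : ℝ) * G) * (t₂ - t₁)) *
        ∑ k : ↥S, 4 * Real.pi ^ 2 * freqNormSq (k : d → ℤ) * ‖α t₁ k‖ ^ 2 := by
  set Z : ℝ → ℝ := fun τ => ∑ k : ↥S, 4 * Real.pi ^ 2 * freqNormSq (k : d → ℤ) * ‖α τ k‖ ^ 2 with hZ
  set Z' : ℝ → ℝ := fun τ => ∑ k : ↥S, 4 * Real.pi ^ 2 * freqNormSq (k : d → ℤ) *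
    (2 * (inner ℂ (α τ k) (pvtGalerkinRHS S 𝔸 (β τ) (α τ) k)).re) with hZ'
  have hsub : Icc t₁ t₂ ⊆ Icc 0 s' := Icc_subset_Icc h0 h2
  have hderiv : ∀ τ ∈ Icc t₁ t₂, HasDerivWithinAt Z (Z' τ) (Icc t₁ t₂) τ := fun τ hτ =>
    (hasDerivWithinAt_weighted_sum_norm_sq (fun k : ↥S => 4 * Real.pi ^ 2 * freqNormSq (k : d → ℤ))
      (hα τ (hsub hτ))).mono hsub
  have hcont : ContinuousOn Z (Icc t₁ t₂) := fun τ hτ => (hderiv τ hτ).continuousWithinAt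
  have hbound : ∀ τ ∈ Ico t₁ t₂, Z' τ ≤ 2 * ((Fintype.card d : ℝ) * G) * Z τ + 0 := by
    intro τ hτ
    rw [add_zero]
    exact pvtEnstrophy_deriv_le h𝔸 hlo hS (hmem τ (hsub (Ico_subset_Icc_self hτ))) (hβr τ) (hβT τ) hG0
      (hG τ (hsub (Ico_subset_Icc_self hτ)))
  have hgron := le_gronwallBound_of_liminf_deriv_right_le (f := Z) (f' := Z') (δ := Z t₁)
    (K := 2 * ((Fintype.card d : ℝ) * G)) (ε := 0) (a := t₁) (b := t₂) hcont (fun τ hτ r hr => ?_) le_rfl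
    hbound t₂ ⟨h12, le_rfl⟩
  · rw [gronwallBound_ε0] at hgron
    exact hgron.trans_eq (mul_comm _ _)
  · have hmem_nhds : Icc t₁ t₂ ∈ 𝓝[Ici τ] τ :=
      mem_nhdsWithin.2 ⟨Iio t₂, isOpen_Iio, hτ.2, fun z hz => ⟨hτ.1.trans hz.2, hz.1.le⟩⟩
    exact ((hderiv τ (Ico_subset_Icc_self hτ)).mono_of_mem_nhdsWithin hmem_nhds) |>.liminf_right_slope_le hr

/-- The Galerkin enstrophy is the squared gradient norm of the approximation:
`4π²Σ_k|k|²‖c k‖² = ‖∇ realTrigPoly S c̄‖²`. [cite: RobinsonRodrigoSadowski2016, Thm. 4.4 Step 2 (4.8)] -/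
theorem sum_freqNormSq_mul_norm_sq_eq_gradNormSq (hS : ∀ k ∈ S, -k ∈ S) {c : ↥S → EuclideanSpace ℂ d}
    (hc : IsRealCoeff c) :
    ∑ k : ↥S, 4 * Real.pi ^ 2 * freqNormSq (k : d → ℤ) * ‖c k‖ ^ 2 =
      FunctionSpaces.Torus.gradNormSq (realTrigPoly S (coeffExt S c)) := by
  rw [gradNormSq_realTrigPoly hS (hc.isConjSymm_coeffExt hS), Finset.mul_sum,
    ← sum_coeffExt (fun k v => 4 * Real.pi ^ 2 * freqNormSq k * ‖v‖ ^ 2) c]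
  exact Finset.sum_congr rfl fun k _ => by ring

/-- **Enstrophy Grönwall bound, gradient-norm form**: `‖∇u_N(t₂)‖² ≤ exp(2·(card d)·G·(t₂−t₁))·‖∇u_N(t₁)‖²`,
`u_N(t) = realTrigPoly S ᾱ(t)`. [cite: RobinsonRodrigoSadowski2016, §6.1] -/
theorem gradNormSq_galerkin_le_exp_mul {𝔸 : Visc4 d} {lo hi : ℝ} (h𝔸 : NearIso 𝔸 lo hi) (hlo : 0 ≤ lo)
    (hS : ∀ k ∈ S, -k ∈ S)
    {β : ℝ → ↥S → EuclideanSpace ℂ d} (hβr : ∀ t, IsRealCoeff (β t)) (hβT : ∀ t, IsSolenoidalCoeff (β t))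
    {s' : ℝ} {α : ℝ → ↥S → EuclideanSpace ℂ d}
    (hα : ∀ t ∈ Icc 0 s', HasDerivWithinAt α (pvtGalerkinRHS S 𝔸 (β t) (α t)) (Icc 0 s') t)
    (hmem : ∀ t ∈ Icc 0 s', α t ∈ galerkinSubspace S) {G : ℝ} (hG0 : 0 ≤ G)
    (hG : ∀ t ∈ Icc 0 s', ∀ x j a, |FunctionSpaces.Torus.partialDeriv j (realTrigPoly S (coeffExt S (β t))) x a| ≤ G)
    {t₁ t₂ : ℝ} (h0 : 0 ≤ t₁) (h12 : t₁ ≤ t₂) (h2 : t₂ ≤ s') :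
    FunctionSpaces.Torus.gradNormSq (realTrigPoly S (coeffExt S (α t₂))) ≤
      Real.exp (2 * ((Fintype.card d : ℝ) * G) * (t₂ - t₁)) *
        FunctionSpaces.Torus.gradNormSq (realTrigPoly S (coeffExt S (α t₁))) := by
  rw [← sum_freqNormSq_mul_norm_sq_eq_gradNormSq hS (hmem t₂ ⟨h0.trans h12, h2⟩).1,
    ← sum_freqNormSq_mul_norm_sq_eq_gradNormSq hS (hmem t₁ ⟨h0, h12.trans h2⟩).1]
  exact pvtEnstrophy_le_exp_mul h𝔸 hlo hS hβr hβT hα hmem hG0 hG h0 h12 h2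

end Literature.Analysis.FluidPDE
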